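import Summits.CriticalPhenomena.PercolationContinuityZ3.Theorems.Transplant.SkelNegBParamsSlotsRS
import Summits.CriticalPhenomena.PercolationContinuityZ3.Theorems.Transplant.SkelNegBParamsFineSize
import HarnessLib

/-!
# N1 params, chain of record `NegB`, part Slots: THE BOX, WIDTH AND PAIR SLOT VALUES OF RECORD (each with a RESIDUAL slot, so a floor posted later costs a value, not a file) —
# `KS.gR mk gx : Neg.FSlot` (box: `max {4K(RA'+2), 16(n_b+ℓ_b+|h_b|), gx}`), `KS.fR mk fx : Neg.FSlot` (width: `max {K(RA'+2), D.k + RA' + pgScale n_b h_b (3ℓ_b) + 1, fx}`,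
# the exact (R-F1) of p3-g9 2026-08-21T15:55:22Z), `KS.PR mk Px : NegB.PSlot` (the bridge pair, the kit pair, and `Px`'s extras, with admissibility), and AT THESE VALUES the floors
# the residues read by name: `ML_floorsR` (box), `nL_floorsR` (width), **`s_ge_of_floor`/`cells_geR`** (`6·RA'+11 ≤ s₀`, `14·RA'+27 ≤ s₁`, `K·(…) ≤ r_i` at the apron `R′`),
# `bridge_mem_PR/kit_mem_PR/extra_subset_PR`; the fibre block `SR` (SchedIn) is part SlotsS (after the (C)/(F) schedule reads under S1)

builds on p205010 (kernel theorem, internal audit signed; external expert review pending) — nothing in this file uses p205010; NOTHING is claimed about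
the node `SamePDropOfSkeletonNeg₁` (OPEN).
Status sentence (coordinator 2026-08-20T04:30Z): "θ(p_c) = 0 on ℤ^d, all d ≥ 2 — kernel-verified (Lean 4/Mathlib, standard axioms); internal adversarial
audit SIGNED 2026-08-20 04:29Z; external expert review pending."
Lane `prim-bschramm-*`, seat `prim-bschramm-stmt` (gen 14); helper file (`--supports stmt-CriticalPhenomena-4575 --as helper`); ledger HOME/prim-bschramm-stmt/NEG-PARAMS.md v0.12.
HOW TO INSTANTIATE (node file / residue wrappers): `negChoiceAllOS (KS.gR mk gx) (KS.fR mk fx) (KS.PR mk Px) Sv` with `mk gx fx := 0`, `Px := PSlot.empty` unless a later floor/pair is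
posted; at `(O, q)` under `hAt` the values are `g := NegB.gOf κ Φ t p O (KS.gR mk gx) = KS.gR mk gx κ Φ t p O.merged` (rfl) etc., and the floor lemmas below apply at `D := O.merged`.
* §1 `gR`, `gR_at` (rfl), `gR_floors`, **`ML_floorsR`** (`4K(RA'+2) ≤ M_L`, `16(n_b+ℓ_b+|h_b|) ≤ M_L`, `gx ≤ M_L`, `4K·RA'+2 ≤ M_L`, `M_L + 1 ≥ 16(…)+1`);
* §2 `fR`, `fR_at`, `fR_floors`, **`nL_floorsR`** (`K(RA'+2) ≤ n_L`, (R-F1) `D.k + RA' + pgScale n_b h_b (3ℓ_b) + 1 ≤ n_L`, `fx ≤ n_L`, `RA' ≤ n_L`, `M_u < n_L`);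
* §3 **`s_ge_of_floor`** (any `r` with `4K(r+2) ≤ M_L`: `6r+11 ≤ s₀ ∧ 14r+27 ≤ s₁`, from `true_size₀/₁`), **`cells_geR`** (at `g := gR`: the apron `R′`), `r_geR`;
* §4 `PR`, `bridge_mem_PR`, `kit_mem_PR`, `extra_subset_PR`; at `AtQO` of `choiceAtOS … (PR mk Px)`: **`inputsK_R`**, **`inputsBR_R`** (no membership hypothesis left);
* §5 **`counts_R`** (part KS's `counts_atq` with the consumer's `[DecidableEq V]` inside `Neg.δkit`), **`counts_δ`** (at `κ.δ`, `κ.δ₂`, `κ.δr n`).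
[cite: KozmaNitzan2024, §4 Theorem 6 (pp. 25–31): the order of constants] [cite: MartineauTassion2017, §3.2 Lemma 3.5]
-/

noncomputable section

open scoped Classical

namespace Summit.CriticalPhenomena.PercolationContinuityZ3.Theorems.Transplant

namespace PlanarSkeletonNeg

namespace NegB

namespace KS

open MeasureTheory Literature.Probability.Percolation Literature.Probability.LatticeModels SimpleGraph
open SkelConc (Consts)
open Skelφ (oriφ trφ)
open Skelφ.StepI (DataN OutO)
open Neg

/-! ## §1 The box slot value -/

/-- **THE BOX FLOOR OF RECORD** (kit index slot `mk`, residual slot `gx`): `g := max {4K(RA'+2), 16(n_b + ℓ_b + |h_b|), gx}` at the merged record. [this work] -/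
def gR (mk gx : ℕ) : Neg.FSlot := fun κ _ _ _ _ _ Φ t p D =>
  max (max (4 * Neg.K κ * (RA' κ Φ t p D mk + 2)) (16 * (nBR κ Φ t p D mk + ℓBR κ Φ t p D mk + (hBR κ Φ t p D mk).natAbs))) gx

section Box

variable (κ : Consts) {V : Type} [DecidableEq V] [Countable V] {G : SimpleGraph V} [G.LocallyFinite] (Φ : PlanarSkeletonNeg G) (t : V)
  (p : unitInterval) (D : DataN V) (mk gx : ℕ)

/-- `gR` at `(κ, Φ, t, p, D)` (by `rfl`). [folklore] -/
theorem gR_at : gR mk gx κ Φ t p D =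
    max (max (4 * Neg.K κ * (RA' κ Φ t p D mk + 2)) (16 * (nBR κ Φ t p D mk + ℓBR κ Φ t p D mk + (hBR κ Φ t p D mk).natAbs))) gx := rfl

/-- The three floors inside `gR`. [folklore] -/
theorem gR_floors : 4 * Neg.K κ * (RA' κ Φ t p D mk + 2) ≤ gR mk gx κ Φ t p D ∧
    16 * (nBR κ Φ t p D mk + ℓBR κ Φ t p D mk + (hBR κ Φ t p D mk).natAbs) ≤ gR mk gx κ Φ t p D ∧ gx ≤ gR mk gx κ Φ t p D :=
  ⟨(le_max_left _ _).trans (le_max_left _ _), (le_max_right _ _).trans (le_max_left _ _), le_max_right _ _⟩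

/-- **THE LONG BOX's FLOORS AT `g := gR`**: `4K(RA'+2) ≤ M_L`, `16(n_b+ℓ_b+|h_b|) ≤ M_L` (bridge ladder: `M_L + 1 ≥ 2C′(…) + 1`), `gx ≤ M_L`, `4K·RA' + 2 ≤ M_L`, `RA' + 2 ≤ M_L`.
[folklore] -/
theorem ML_floorsR : 4 * Neg.K κ * (RA' κ Φ t p D mk + 2) ≤ ML κ Φ t p D (gR mk gx κ Φ t p D) ∧
    16 * (nBR κ Φ t p D mk + ℓBR κ Φ t p D mk + (hBR κ Φ t p D mk).natAbs) ≤ ML κ Φ t p D (gR mk gx κ Φ t p D) ∧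
    gx ≤ ML κ Φ t p D (gR mk gx κ Φ t p D) ∧ 4 * Neg.K κ * RA' κ Φ t p D mk + 2 ≤ ML κ Φ t p D (gR mk gx κ Φ t p D) ∧
    RA' κ Φ t p D mk + 2 ≤ ML κ Φ t p D (gR mk gx κ Φ t p D) := by
  have hg := (ML_le_ML κ Φ t p D (gR mk gx κ Φ t p D)).2
  obtain ⟨h1, h2, h3⟩ := gR_floors κ Φ t p D mk gx
  have hK := (Neg.forty_le_K κ).1
  refine ⟨h1.trans hg, h2.trans hg, h3.trans hg, ?_, ?_⟩
  · have : 4 * Neg.K κ * RA' κ Φ t p D mk + 2 ≤ 4 * Neg.K κ * (RA' κ Φ t p D mk + 2) := by nlinarith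
    exact this.trans (h1.trans hg)
  · have : RA' κ Φ t p D mk + 2 ≤ 4 * Neg.K κ * (RA' κ Φ t p D mk + 2) := by nlinarith
    exact this.trans (h1.trans hg)

/-- The ℤ form `4K(RA'+2) ≤ M_L`. [folklore] -/
theorem ML_floorR_int : 4 * (Neg.K κ : ℤ) * ((RA' κ Φ t p D mk : ℤ) + 2) ≤ (ML κ Φ t p D (gR mk gx κ Φ t p D) : ℤ) := by
  exact_mod_cast (ML_floorsR κ Φ t p D mk gx).1

end Box

/-! ## §2 The width slot value -/

/-- **THE WIDTH FLOOR OF RECORD** (slots `mk`, residual `fx`): `f := max {K(RA'+2), D.k + RA' + pgScale n_b h_b (3ℓ_b) + 1, fx}` ((R-F1) exact). [this work] -/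
def fR (mk fx : ℕ) : Neg.FSlot := fun κ _ _ _ _ _ Φ t p D =>
  max (max (Neg.K κ * (RA' κ Φ t p D mk + 2)) (D.k + RA' κ Φ t p D mk + Skelφ.pgScale (nBR κ Φ t p D mk) (hBR κ Φ t p D mk) (3 * ℓBR κ Φ t p D mk) + 1)) fx

section Width

variable (κ : Consts) {V : Type} [DecidableEq V] [Countable V] {G : SimpleGraph V} [G.LocallyFinite] (Φ : PlanarSkeletonNeg G) (t : V)
  (p : unitInterval) (D : DataN V) (mk fx g : ℕ)

/-- `fR` at `(κ, Φ, t, p, D)` (by `rfl`). [folklore] -/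
theorem fR_at : fR mk fx κ Φ t p D =
    max (max (Neg.K κ * (RA' κ Φ t p D mk + 2)) (D.k + RA' κ Φ t p D mk + Skelφ.pgScale (nBR κ Φ t p D mk) (hBR κ Φ t p D mk) (3 * ℓBR κ Φ t p D mk) + 1)) fx :=
  rfl

/-- The three floors inside `fR`. [folklore] -/
theorem fR_floors : Neg.K κ * (RA' κ Φ t p D mk + 2) ≤ fR mk fx κ Φ t p D ∧
    D.k + RA' κ Φ t p D mk + Skelφ.pgScale (nBR κ Φ t p D mk) (hBR κ Φ t p D mk) (3 * ℓBR κ Φ t p D mk) + 1 ≤ fR mk fx κ Φ t p D ∧ fx ≤ fR mk fx κ Φ t p D :=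
  ⟨(le_max_left _ _).trans (le_max_left _ _), (le_max_right _ _).trans (le_max_left _ _), le_max_right _ _⟩

/-- **THE LONG WIDTH's FLOORS AT `f := fR`** (any box value `g`): `K(RA'+2) ≤ n_L`, (R-F1) `D.k + RA' + pgScale n_b h_b (3ℓ_b) + 1 ≤ n_L`, `fx ≤ n_L`, `RA' + 2 ≤ n_L`, `M_u < n_L`,
`n_b ≤ n_L`. [folklore] -/
theorem nL_floorsR : Neg.K κ * (RA' κ Φ t p D mk + 2) ≤ nL κ Φ t p D g (fR mk fx κ Φ t p D) ∧
    D.k + RA' κ Φ t p D mk + Skelφ.pgScale (nBR κ Φ t p D mk) (hBR κ Φ t p D mk) (3 * ℓBR κ Φ t p D mk) + 1 ≤ nL κ Φ t p D g (fR mk fx κ Φ t p D) ∧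
    fx ≤ nL κ Φ t p D g (fR mk fx κ Φ t p D) ∧ RA' κ Φ t p D mk + 2 ≤ nL κ Φ t p D g (fR mk fx κ Φ t p D) ∧ Mu D < nL κ Φ t p D g (fR mk fx κ Φ t p D) ∧
    nBR κ Φ t p D mk ≤ nL κ Φ t p D g (fR mk fx κ Φ t p D) := by
  have hf := (n₁L_le_nL κ Φ t p D g (fR mk fx κ Φ t p D)).2
  obtain ⟨h1, h2, h3⟩ := fR_floors κ Φ t p D mk fx
  have hK := (Neg.forty_le_K κ).2.2
  have hMu : Mu D < nL κ Φ t p D g (fR mk fx κ Φ t p D) := lt_of_le_of_lt (Mu_le_ML κ Φ t p D g) (ML_lt_nL κ Φ t p D g _).1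
  refine ⟨h1.trans hf, h2.trans hf, h3.trans hf, ?_, hMu, ?_⟩
  · have : RA' κ Φ t p D mk + 2 ≤ Neg.K κ * (RA' κ Φ t p D mk + 2) := Nat.le_mul_of_pos_left _ hK
    exact this.trans (h1.trans hf)
  · have : nBR κ Φ t p D mk ≤ Skelφ.pgScale (nBR κ Φ t p D mk) (hBR κ Φ t p D mk) (3 * ℓBR κ Φ t p D mk) := le_max_left _ _
    omega

end Width

/-! ## §3 The cells at the apron `R′` -/

section Cells

variable (κ : Consts) {V : Type} [DecidableEq V] [Countable V] {G : SimpleGraph V} [G.LocallyFinite] (Φ : PlanarSkeletonNeg G) (t : V)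
  (p : unitInterval) (D : DataN V) (g f : ℕ)

/-- **TRUE CELL SIZES UNDER A BOX FLOOR**: for ANY `r` with `4K(r+2) ≤ M_L`, `6r + 11 ≤ s₀` and `14r + 27 ≤ s₁` (from `true_size₀/₁`: `40·M_L ≤ 23·K·(s₀+2)`, `≤ 11·K·(s₁+2)`).
[folklore] -/
theorem s_ge_of_floor (hN : EqNumL κ Φ t p D g f) (hκ : (hL κ Φ t p D g f).natAbs ≤ 10 * nL κ Φ t p D g f) {r : ℕ} (hr : 4 * Neg.K κ * (r + 2) ≤ ML κ Φ t p D g) :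
    6 * (r : ℤ) + 11 ≤ (((fcells κ Φ t p D g f).s 0 : ℕ) : ℤ) ∧ 14 * (r : ℤ) + 27 ≤ (((fcells κ Φ t p D g f).s 1 : ℕ) : ℤ) := by
  have h0 := true_size₀ κ Φ t p D g f hN hκ
  have h1 := true_size₁ κ Φ t p D g f hN hκ
  have hr' : 4 * (Neg.K κ : ℤ) * ((r : ℤ) + 2) ≤ (ML κ Φ t p D g : ℤ) := by exact_mod_cast hr
  have hK : (40 : ℤ) ≤ Neg.K κ := by exact_mod_cast (Neg.forty_le_K κ).1
  constructor
  · -- 160 K (r+2) ≤ 23 K (s₀+2)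
    have h : 160 * (Neg.K κ : ℤ) * ((r : ℤ) + 2) ≤ 23 * (Neg.K κ : ℤ) * ((((fcells κ Φ t p D g f).s 0 : ℕ) : ℤ) + 2) := by linarith
    have h' : 160 * ((r : ℤ) + 2) ≤ 23 * ((((fcells κ Φ t p D g f).s 0 : ℕ) : ℤ) + 2) := by
      by_contra hc; push Not at hc; nlinarith
    omega
  · have h : 160 * (Neg.K κ : ℤ) * ((r : ℤ) + 2) ≤ 11 * (Neg.K κ : ℤ) * ((((fcells κ Φ t p D g f).s 1 : ℕ) : ℤ) + 2) := by linarith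
    have h' : 160 * ((r : ℤ) + 2) ≤ 11 * ((((fcells κ Φ t p D g f).s 1 : ℕ) : ℤ) + 2) := by
      by_contra hc; push Not at hc; nlinarith
    omega

variable (mk gx : ℕ)

/-- **THE CELLS AT `g := gR`**: `6·RA' + 11 ≤ s₀` and `14·RA' + 27 ≤ s₁` (the apron `R′`; any width `f`). [folklore] -/
theorem cells_geR (hN : EqNumL κ Φ t p D (gR mk gx κ Φ t p D) f) (hκ : (hL κ Φ t p D (gR mk gx κ Φ t p D) f).natAbs ≤ 10 * nL κ Φ t p D (gR mk gx κ Φ t p D) f) :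
    6 * (RA' κ Φ t p D mk : ℤ) + 11 ≤ (((fcells κ Φ t p D (gR mk gx κ Φ t p D) f).s 0 : ℕ) : ℤ) ∧
      14 * (RA' κ Φ t p D mk : ℤ) + 27 ≤ (((fcells κ Φ t p D (gR mk gx κ Φ t p D) f).s 1 : ℕ) : ℤ) :=
  s_ge_of_floor κ Φ t p D _ f hN hκ (ML_floorsR κ Φ t p D mk gx).1

/-- **The fine radii at `g := gR`**: `K·(6RA'+11) ≤ r₀`, `K·(14RA'+27) ≤ r₁`. [folklore] -/
theorem r_geR (hN : EqNumL κ Φ t p D (gR mk gx κ Φ t p D) f) (hκ : (hL κ Φ t p D (gR mk gx κ Φ t p D) f).natAbs ≤ 10 * nL κ Φ t p D (gR mk gx κ Φ t p D) f) :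
    (Neg.K κ : ℤ) * (6 * (RA' κ Φ t p D mk : ℤ) + 11) ≤ ((fcells κ Φ t p D (gR mk gx κ Φ t p D) f).r 0 : ℤ) ∧
      (Neg.K κ : ℤ) * (14 * (RA' κ Φ t p D mk : ℤ) + 27) ≤ ((fcells κ Φ t p D (gR mk gx κ Φ t p D) f).r 1 : ℤ) := by
  obtain ⟨h0, h1⟩ := cells_geR κ Φ t p D f mk gx hN hκ
  have hr := (fcells_K κ Φ t p D (gR mk gx κ Φ t p D) f).2.2
  have hK : (0 : ℤ) ≤ Neg.K κ := by positivity
  rw [hr 0, hr 1]; push_cast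
  exact ⟨by nlinarith, by nlinarith⟩

end Cells

/-! ## §4 The pair slot value -/

/-- **THE PAIR LIST OF RECORD** (slot `mk`, residual pair slot `Px`): the bridge pair `(M_b, n_b)`, the kit pair `(M_kit, n_kit)`, and `Px`'s extras — each admissible. [this work] -/
def PR (mk : ℕ) (Px : PSlot) : PSlot := fun κ _ _ _ _ _ Φ t p D =>
  ⟨{(MBR κ Φ t p D mk, nBR κ Φ t p D mk), (MK D mk, nKit D mk)} ∪ (Px κ Φ t p D).1, fun q hq => by
    rcases Finset.mem_union.1 hq with h | h
    · rcases Finset.mem_insert.1 h with rfl | h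
      · exact bridgeR_adm κ Φ t p D mk
      · rw [Finset.mem_singleton] at h; subst h; exact kit_adm D mk
    · exact (Px κ Φ t p D).2 q h⟩

section Pairs

variable (κ : Consts) {V : Type} [DecidableEq V] [Countable V] {G : SimpleGraph V} [G.LocallyFinite] (Φ : PlanarSkeletonNeg G) (t : V)
  (p : unitInterval) (D : DataN V) (mk : ℕ) (Px : PSlot)

/-- The bridge pair is listed. [folklore] -/
theorem bridge_mem_PR : (MBR κ Φ t p D mk, nBR κ Φ t p D mk) ∈ (PR mk Px κ Φ t p D).1 :=
  Finset.mem_union_left _ (Finset.mem_insert_self _ _)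

/-- The kit pair is listed. [folklore] -/
theorem kit_mem_PR : (MK D mk, nKit D mk) ∈ (PR mk Px κ Φ t p D).1 :=
  Finset.mem_union_left _ (Finset.mem_insert_of_mem (Finset.mem_singleton_self _))

/-- The extra pairs are listed. [folklore] -/
theorem extra_subset_PR : (Px κ Φ t p D).1 ⊆ (PR mk Px κ Φ t p D).1 := Finset.subset_union_right

end Pairs

section AtQ

variable {κ : Consts} {V : Type} [DecidableEq V] [Countable V] {G : SimpleGraph V} [G.LocallyFinite] {Φ : PlanarSkeletonNeg G} {t : V} {p : unitInterval}
  {hC : Φ.CylSubcritical p} {gv fv : Neg.FSlot} {Px : PSlot} {Sv : SSlot} {O : OutO V} {q : unitInterval} (mk : ℕ)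

/-- **THE KIT PAIR's PIECE-LINKS at `q` with `Pv := PR mk Px`** (map `φK`; no membership hypothesis left). [this work] -/
theorem inputsK_R (hAt : (choiceAtOS κ Φ t p gv fv Sv hC (PR mk Px)).AtQO O q) (fam : Fin 2) (σ τ : ℤˣ) :
    1 - Neg.δI κ Φ <
      (bondPercolation G q).real (Skelφ.StepI.eventN G (φK Φ t O.D O.DT O.ori mk) O.merged (t, MK O.merged mk, some (nKit O.merged mk, fam, σ, τ))) :=
  inputsK_of_atQOS mk hAt (kit_mem_PR κ Φ t p O.merged mk Px) fam σ τ

/-- **THE BRIDGE PAIR's PIECE-LINKS at `q` with `Pv := PR mk Px`** (map `φB … mbR bR`; no membership hypothesis left). [this work] -/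
theorem inputsBR_R (hAt : (choiceAtOS κ Φ t p gv fv Sv hC (PR mk Px)).AtQO O q) (fam : Fin 2) (σ τ : ℤˣ) :
    1 - Neg.δI κ Φ <
      (bondPercolation G q).real (Skelφ.StepI.eventN G (φB Φ t O.D O.DT O.ori (mbR κ Φ t p O.merged mk) (bR κ Φ t p O.merged mk)) O.merged
        (t, MBR κ Φ t p O.merged mk, some (nBR κ Φ t p O.merged mk, fam, σ, τ))) :=
  inputsBR_of_atQOS mk hAt (bridge_mem_PR κ Φ t p O.merged mk Px) fam σ τ

end AtQ

/-! ## §5 The kit counts with the consumer's instances -/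

section CountsD

variable (κ : Consts) {V : Type} [DecidableEq V] [Countable V] {G : SimpleGraph V} [G.LocallyFinite] (Φ : PlanarSkeletonNeg G) (t : V)
  (p : unitInterval) (D : DataN V) (mk : ℕ)

/-- **THE COUNTS AT EVERY `q ∈ [p/2, p]`, consumer's `[DecidableEq V]` instance inside `Neg.δkit`** (part KS's `counts_atq` carries the classical instance in its `hδ'`; the two
`δkit`s agree by `Subsingleton.elim`, discharged by `convert`): `(1 − q^{sB})^{kk} ≤ δ'` and `1/(1−q)^{Δ·Nk} ≤ δ'·card[j₀,j₁]` for every `δ' ≥ δkit`. [folklore] -/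
theorem counts_R (hp0 : 0 < (p : ℝ)) (hp1 : (p : ℝ) < 1) {q : unitInterval} (hq1 : (p : ℝ) / 2 ≤ q) (hq2 : (q : ℝ) ≤ p) {δ' : ℝ} (hδ' : Neg.δkit κ Φ ≤ δ') :
    (1 - (q : ℝ) ^ (1 + Φ.Δ * cSA Φ t D mk + cSA Φ t D mk * cUA Φ t D mk)) ^ kkA κ Φ t p D mk ≤ δ' ∧
      1 / (1 - (q : ℝ)) ^ (Φ.Δ * NkA κ Φ t p D mk) ≤ δ' * ((Finset.Icc (j₀A t D mk) (j₁A κ Φ t p D mk)).card : ℝ) := by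
  have hδ'' : @Neg.δkit κ V (fun a b => Classical.propDecidable (a = b)) _ G _ Φ ≤ δ' := by convert hδ' using 2
  exact counts_atq κ Φ t p D mk hp0 hp1 hq1 hq2 hδ''

/-- The counts at the three residue accuracies `κ.δ` ((C)), `κ.δ₂` ((F)), `κ.δr n` for `n ≤ 1000` ((R)). [folklore] -/
theorem counts_δ (hp0 : 0 < (p : ℝ)) (hp1 : (p : ℝ) < 1) {q : unitInterval} (hq1 : (p : ℝ) / 2 ≤ q) (hq2 : (q : ℝ) ≤ p) :
    ((1 - (q : ℝ) ^ (1 + Φ.Δ * cSA Φ t D mk + cSA Φ t D mk * cUA Φ t D mk)) ^ kkA κ Φ t p D mk ≤ κ.δ ∧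
      1 / (1 - (q : ℝ)) ^ (Φ.Δ * NkA κ Φ t p D mk) ≤ κ.δ * ((Finset.Icc (j₀A t D mk) (j₁A κ Φ t p D mk)).card : ℝ)) ∧
    ((1 - (q : ℝ) ^ (1 + Φ.Δ * cSA Φ t D mk + cSA Φ t D mk * cUA Φ t D mk)) ^ kkA κ Φ t p D mk ≤ κ.δ₂ ∧
      1 / (1 - (q : ℝ)) ^ (Φ.Δ * NkA κ Φ t p D mk) ≤ κ.δ₂ * ((Finset.Icc (j₀A t D mk) (j₁A κ Φ t p D mk)).card : ℝ)) ∧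
    (∀ n ≤ 1000, (1 - (q : ℝ) ^ (1 + Φ.Δ * cSA Φ t D mk + cSA Φ t D mk * cUA Φ t D mk)) ^ kkA κ Φ t p D mk ≤ κ.δr n ∧
      1 / (1 - (q : ℝ)) ^ (Φ.Δ * NkA κ Φ t p D mk) ≤ κ.δr n * ((Finset.Icc (j₀A t D mk) (j₁A κ Φ t p D mk)).card : ℝ)) :=
  ⟨counts_R κ Φ t p D mk hp0 hp1 hq1 hq2 (Neg.δkit_le_δ κ Φ), counts_R κ Φ t p D mk hp0 hp1 hq1 hq2 (Neg.δkit_le_δ₂ κ Φ),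
    fun _ hn => counts_R κ Φ t p D mk hp0 hp1 hq1 hq2 (Neg.δkit_le_δr κ Φ hn)⟩

end CountsD

end KS

end NegB

end PlanarSkeletonNeg

end Summit.CriticalPhenomena.PercolationContinuityZ3.Theorems.Transplant

end
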